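import Literature.Barriers.AtomisticToContinuum.NoBVEstimatesMultiDFinitePropagationProofs
import Literature.LinearAlgebra.Matrix.HornerSymmetrizer
import Literature.LinearAlgebra.Matrix.StrictlyHyperbolicPencil
import HarnessLib

/-!
# Finite speed of propagation for Rauch's class: strictly hyperbolic systems in one space
dimension are symmetrizable, and the symbolic symmetrizer in general

`NoBVEstimatesMultiDFinitePropagation.lean` splits the named fact
`Rauch1986_finitePropagationSpeed` [Rauch1986, Proof of Theorem p. 482: "Using the finite speed
of propagation for (1)"] into its symmetrizable case — DISCHARGED
(`Rauch1986_finitePropagationSpeed_symmetrizable_holds`,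
`NoBVEstimatesMultiDFinitePropagationProofs.lean`) — and its strictly hyperbolic case (the
remaining proof obligation of the fact, carried as an explicit hypothesis and not as a named
fact of its own; `k ≤ 1` proved there, `exists_hasPropagationSpeed_of_isRauchClass_of_le_one`).
This file proves the strictly hyperbolic case in ONE SPACE DIMENSION (`d = 1`, and the
degenerate `d = 0`), for every `k`, by exhibiting a smooth symmetrizer and invoking the
discharged symmetrizable case:

* For `d = 1` Rauch's hypothesis is: `A₀(u)` invertible and `A₀(u)⁻¹A₁(u)` with `k` distinct
  real eigenvalues near `ū`. A real matrix with simple real spectrum is symmetrizable — it is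
  "similar to `A*` via a positive definite similarity" [HornJohnson2013, §7.6 Problem 7.6.P1
  (b) ⇔ (d)]; classically `H = P⁻ᵀP⁻¹` from the diagonalisation `P⁻¹S⁻¹AP = Λ` of a strictly
  hyperbolic system in one space dimension [AlinhacHPDE2009, Ch. 2 §2.2] — and the tree's
  `Literature.LinearAlgebra.Matrix.hornerSymmetrizer` gives such an `H(M)` as a POLYNOMIAL in
  the entries of `M` (`posDef_hornerSymmetrizer`, `isSymm_hornerSymmetrizer_mul`). Hence
  `Sym(u) = det A₀(u) · H(adj A₀(u) A₁(u)) · adj A₀(u)` (`symmetrizerOfPair`) is smooth in `u`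
  (a polynomial in the entries of `A₀(u), A₁(u)`: `contDiff_symmetrizerOfPair_apply`, via the
  subalgebra of smooth functions and functoriality `symmetrizerOfPair_map`), with
  `Sym A₀ = det(A₀)² H` symmetric positive definite and `Sym A₁ = det(A₀) H·(adj A₀ A₁)`
  symmetric: `IsStrictlyHyperbolicNear.isSymmetrizableNear_of_d_eq_one`. For `d = 0` the
  hypothesis is just `det A₀ ≠ 0` and `Sym = A₀ᵀ` symmetrizes.
* Consequences: `hasPropagationSpeed_of_isStrictlyHyperbolicNear_of_d_eq_one`,
  `exists_hasPropagationSpeed_of_isRauchClass_of_d_le_one` (Rauch's fact unconditionally for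
  `d ≤ 1`, Rauch's Example 1), and the reductions
  `Rauch1986_finitePropagationSpeed_strictlyHyperbolic_of_two_le`,
  `Rauch1986_finitePropagationSpeed_of_two_le`: the named fact
  `Rauch1986_finitePropagationSpeed` now rests only on its case `d ≥ 2`, `k ≥ 2` (strictly
  hyperbolic, not assumed symmetrizable) — the genuinely pseudodifferential case
  [Taylor1981, Ch. IV §3 Prop. 3.1, §4 Thm 4.5].
* The same algebra in every dimension: the **symbolic symmetrizer**
  `r(u, ξ) = symmetrizerOfPair (A₀(u)) (Σⱼ ξⱼAⱼ(u))`, jointly smooth (polynomial in `ξ`), with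
  `r A₀` symmetric positive definite and `r · Σ ξⱼAⱼ` symmetric for `ξ ≠ 0` and `u` near `ū`
  (`IsStrictlyHyperbolicNear.exists_symbolicSymmetrizer`) — the symbol-level input
  ("`r₀(t,x,ξ)` is a positive definite matrix; `r₀P₁` is self adjoint") of the symmetrizer
  construction for strictly hyperbolic operators [Taylor1981, Ch. IV §3 Def. 3.2, Prop. 3.1],
  here without the normalisation to degree `0` (restrict `ξ` to the unit sphere).

## References

* [Rauch1986] J. Rauch, Comm. Math. Phys. 106 (1986) 481–484: p. 482 (the class; "Using the
  finite speed of propagation for (1)"), Example 1 (`d = 1`).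
* [HornJohnson2013] R. A. Horn, C. R. Johnson, *Matrix Analysis*, 2nd ed. (2013), §7.6
  Problem 7.6.P1, Cor. 7.6.2.
* [AlinhacHPDE2009] S. Alinhac, *Hyperbolic Partial Differential Equations* (2009), Ch. 2 §2.2,
  Def. 2.11 (strictly hyperbolic / symmetric hyperbolic systems in one space dimension and
  their diagonalisation).
* [Taylor1981] M. E. Taylor, *Pseudodifferential Operators* (1981), Ch. IV §3 Def. 3.2,
  Prop. 3.1; §4 Thm 4.5.
-/

noncomputable section

open Set Filter Matrix Polynomial
open scoped Topology ContDiff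

namespace Literature.Barriers.AtomisticToContinuum

open Literature.Analysis.FluidPDE Literature.LinearAlgebra.Matrix

/-! ### The symmetrizer of a pair `(A₀, A₁)`, over any commutative ring -/

section Pair

variable {R : Type*} [CommRing R] {n : Type*} [Fintype n] [DecidableEq n]

/-- **The symmetrizer of a pair** `(A₀, A₁)`: `Sym = det A₀ · H(adj A₀ · A₁) · adj A₀` with `H`
the polynomial symmetrizer `hornerSymmetrizer` — a polynomial in the entries of `A₀, A₁`
(denominator-free form of `H(A₀⁻¹A₁) A₀⁻¹`). [cite: HornJohnson2013, §7.6 Problem 7.6.P1] -/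
def symmetrizerOfPair (A₀ A₁ : Matrix n n R) : Matrix n n R :=
  A₀.det • (hornerSymmetrizer (A₀.adjugate * A₁) * A₀.adjugate)

/-- `Sym · A₀ = det(A₀)² · H(adj A₀ · A₁)` (`adj A₀ · A₀ = det A₀ · 1`). [folklore] -/
theorem symmetrizerOfPair_mul_left (A₀ A₁ : Matrix n n R) :
    symmetrizerOfPair A₀ A₁ * A₀ = (A₀.det ^ 2) • hornerSymmetrizer (A₀.adjugate * A₁) := by
  rw [symmetrizerOfPair, smul_mul_assoc, Matrix.mul_assoc, adjugate_mul, mul_smul_comm, mul_one,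
    smul_smul, sq]

/-- `Sym · A₁ = det A₀ · (H(M̃) M̃)` with `M̃ = adj A₀ · A₁`. [folklore] -/
theorem symmetrizerOfPair_mul_right (A₀ A₁ : Matrix n n R) :
    symmetrizerOfPair A₀ A₁ * A₁ =
      A₀.det • (hornerSymmetrizer (A₀.adjugate * A₁) * (A₀.adjugate * A₁)) := by
  rw [symmetrizerOfPair, smul_mul_assoc, Matrix.mul_assoc]

/-- `Sym · A₀` is symmetric. [cite: HornJohnson2013, §7.6 Problem 7.6.P1] -/
theorem isSymm_symmetrizerOfPair_mul_left (A₀ A₁ : Matrix n n R) :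
    (symmetrizerOfPair A₀ A₁ * A₀).IsSymm := by
  rw [symmetrizerOfPair_mul_left]
  exact (isSymm_hornerSymmetrizer _).smul _

/-- `Sym · A₁` is symmetric. [cite: HornJohnson2013, §7.6 Problem 7.6.P1] -/
theorem isSymm_symmetrizerOfPair_mul_right (A₀ A₁ : Matrix n n R) :
    (symmetrizerOfPair A₀ A₁ * A₁).IsSymm := by
  rw [symmetrizerOfPair_mul_right]
  exact (isSymm_hornerSymmetrizer_mul _).smul _

/-- **Functoriality**: the symmetrizer of a pair commutes with ring homomorphisms (it is a
polynomial in the entries). [folklore] -/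
theorem symmetrizerOfPair_map {S : Type*} [CommRing S] (f : R →+* S) (A₀ A₁ : Matrix n n R) :
    symmetrizerOfPair (A₀.map f) (A₁.map f) = (symmetrizerOfPair A₀ A₁).map f := by
  have hadj : (A₀.map f).adjugate = A₀.adjugate.map f := by
    have h := RingHom.map_adjugate f A₀
    simp only [RingHom.mapMatrix_apply] at h
    exact h.symm
  have hdet : (A₀.map f).det = f A₀.det := by
    rw [RingHom.map_det, RingHom.mapMatrix_apply]
  rw [symmetrizerOfPair, symmetrizerOfPair, hadj, hdet, ← Matrix.map_mul, hornerSymmetrizer_map,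
    ← Matrix.map_mul, map_smul_ringHom]

end Pair

/-! ### Positive definiteness over `ℝ` -/

section RealPair

variable {n : Type*} [Fintype n] [DecidableEq n]

omit [DecidableEq n] in
/-- Positive multiples of positive definite real matrices are positive definite. [folklore] -/
theorem posDef_smul_of_pos {H : Matrix n n ℝ} (hH : H.PosDef) {c : ℝ} (hc : 0 < c) :
    (c • H).PosDef := by
  refine Matrix.PosDef.of_dotProduct_mulVec_pos ?_ fun x hx => ?_
  · show (c • H)ᴴ = c • H
    rw [conjTranspose_smul, star_trivial, hH.isHermitian.eq]
  · rw [smul_mulVec, dotProduct_smul, smul_eq_mul]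
    exact mul_pos hc (hH.dotProduct_mulVec_pos hx)

/-- **`Sym · A₀` is positive definite** when `det A₀ ≠ 0` and `adj A₀ · A₁` has simple real
spectrum. [cite: HornJohnson2013, §7.6 Problem 7.6.P1] -/
theorem posDef_symmetrizerOfPair_mul_left {ι : Type*} [Fintype ι] [DecidableEq ι]
    {A₀ A₁ : Matrix n n ℝ} (hdet : A₀.det ≠ 0) {μ : ι → ℝ} (hμ : Function.Injective μ)
    (hchar : (A₀.adjugate * A₁).charpoly = ∏ a, (X - C (μ a))) :
    (symmetrizerOfPair A₀ A₁ * A₀).PosDef := by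
  rw [symmetrizerOfPair_mul_left]
  exact posDef_smul_of_pos (posDef_hornerSymmetrizer hμ hchar) (pow_pos (sq_pos_of_ne_zero hdet) 1 |>.trans_eq
    (by ring))

end RealPair

/-! ### Smooth dependence: the subalgebra of smooth functions -/

section Smooth

variable (E : Type*) [NormedAddCommGroup E] [NormedSpace ℝ E]

/-- The subalgebra of `C^∞` real-valued functions on a normed space `E`. [folklore] -/
def smoothSubalgebra : Subalgebra ℝ (E → ℝ) where
  carrier := {f | ContDiff ℝ ∞ f}
  mul_mem' hf hg := by
    simp only [Set.mem_setOf_eq] at hf hg ⊢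
    exact hf.mul hg
  one_mem' := by
    simp only [Set.mem_setOf_eq]
    exact contDiff_const
  add_mem' hf hg := by
    simp only [Set.mem_setOf_eq] at hf hg ⊢
    exact hf.add hg
  zero_mem' := by
    simp only [Set.mem_setOf_eq]
    exact contDiff_const
  algebraMap_mem' c := by
    simp only [Set.mem_setOf_eq]
    exact contDiff_const

variable {E}

/-- Evaluation at a point is a ring homomorphism on smooth functions. [folklore] -/
def smoothEval (u : E) : smoothSubalgebra E →+* ℝ where
  toFun f := f.1 u
  map_one' := rfl
  map_mul' _ _ := rfl
  map_zero' := rfl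
  map_add' _ _ := rfl

/-- A matrix field with smooth entries, as a matrix over the algebra of smooth functions.
[folklore] -/
def smoothMatrix {m m' : Type*} (A : E → Matrix m m' ℝ) (hA : ∀ i j, ContDiff ℝ ∞ fun u => A u i j) :
    Matrix m m' (smoothSubalgebra E) :=
  Matrix.of fun i j => ⟨fun u => A u i j, hA i j⟩

/-- Evaluating the lifted matrix field entrywise recovers the field. [folklore] -/
theorem smoothMatrix_map_smoothEval {m m' : Type*} (A : E → Matrix m m' ℝ)
    (hA : ∀ i j, ContDiff ℝ ∞ fun u => A u i j) (u : E) :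
    (smoothMatrix A hA).map (smoothEval u) = A u := by
  ext i j
  rfl

variable {n : Type*} [Fintype n] [DecidableEq n]

/-- **The symmetrizer of a pair of smooth matrix fields has smooth entries** (it is a polynomial
in the entries: lift to matrices over the algebra of smooth functions and use functoriality).
[folklore] -/
theorem contDiff_symmetrizerOfPair_apply {A₀ A₁ : E → Matrix n n ℝ}
    (h₀ : ∀ i j, ContDiff ℝ ∞ fun u => A₀ u i j) (h₁ : ∀ i j, ContDiff ℝ ∞ fun u => A₁ u i j)
    (i j : n) : ContDiff ℝ ∞ fun u => symmetrizerOfPair (A₀ u) (A₁ u) i j := by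
  set Sym := symmetrizerOfPair (smoothMatrix A₀ h₀) (smoothMatrix A₁ h₁) with hSym
  have key : (fun u => symmetrizerOfPair (A₀ u) (A₁ u) i j) = fun u => (Sym i j).1 u := by
    funext u
    have h := symmetrizerOfPair_map (smoothEval u) (smoothMatrix A₀ h₀) (smoothMatrix A₁ h₁)
    rw [smoothMatrix_map_smoothEval, smoothMatrix_map_smoothEval] at h
    rw [h, ← hSym, Matrix.map_apply]
    rfl
  rw [key]
  exact (Sym i j).2

end Smooth

/-! ### Strictly hyperbolic systems in one space dimension are symmetrizable -/

namespace QuasilinearSystem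

variable {d k : ℕ}

/-- Under Rauch's strict hyperbolicity at `u` with `det A₀(u) ≠ 0`: for `ξ ≠ 0` the matrix
`adj A₀(u) · Σⱼ ξⱼAⱼ(u) = det A₀(u) · (A₀(u)⁻¹ Σⱼ ξⱼAⱼ(u))` has simple real spectrum
(eigenvalues `det A₀ · λᵢ`). [cite: Rauch1986, p. 482] -/
theorem IsStrictlyHyperbolicAt.charpoly_adjugate_mul_eq_prod {S : QuasilinearSystem d k}
    {u : Fin k → ℝ} (hdet : (S.A0 u).det ≠ 0) (h : S.IsStrictlyHyperbolicAt u) {ξ : Fin d → ℝ}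
    (hξ : ξ ≠ 0) :
    ∃ lam : Fin k → ℝ, Function.Injective lam ∧
      ((S.A0 u).adjugate * ∑ j, ξ j • S.A j u).charpoly = ∏ i, (X - C (lam i)) := by
  obtain ⟨lam, hinj, hv⟩ := h ξ hξ
  have hadj : (S.A0 u).adjugate = (S.A0 u).det • (S.A0 u)⁻¹ := by
    have hunit : IsUnit (S.A0 u).det := isUnit_iff_ne_zero.2 hdet
    calc (S.A0 u).adjugate = (S.A0 u)⁻¹ * (S.A0 u) * (S.A0 u).adjugate := by
          rw [nonsing_inv_mul _ hunit, Matrix.one_mul]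
      _ = (S.A0 u).det • (S.A0 u)⁻¹ := by
          rw [Matrix.mul_assoc, mul_adjugate, mul_smul_comm, Matrix.mul_one]
  refine ⟨fun i => (S.A0 u).det * lam i, fun i i' hii' => hinj (mul_left_cancel₀ hdet hii'),
    eq_prod_X_sub_C_of_injective_of_isRoot (Matrix.charpoly_monic _)
      ((Matrix.charpoly_natDegree_eq_dim _).trans (Fintype.card_fin k))
      (fun i i' hii' => hinj (mul_left_cancel₀ hdet hii')) fun i => ?_⟩
  obtain ⟨v, hv0, hv⟩ := hv i
  refine isRoot_charpoly_of_mulVec_eq hv0 ?_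
  rw [hadj, smul_mul_assoc, smul_mulVec, hv, smul_smul]

/-- **Strictly hyperbolic systems in one space dimension are symmetrizable near `ū`**, with the
smooth symmetrizer `Sym(u) = det A₀(u) · H(adj A₀(u) A₁(u)) · adj A₀(u)` (`H` the polynomial
symmetrizer of a matrix with simple real spectrum): `Sym A₀ = det(A₀)² H` is symmetric positive
definite and `Sym A₁ = det(A₀) H (adj A₀ A₁)` is symmetric wherever `det A₀ ≠ 0` and `A₀⁻¹A₁`
has `k` distinct real eigenvalues. [cite: HornJohnson2013, §7.6 Problem 7.6.P1;
AlinhacHPDE2009, Ch. 2 §2.2] -/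
theorem IsStrictlyHyperbolicNear.isSymmetrizableNear_of_d_eq_one {S : QuasilinearSystem 1 k}
    {ubar : Fin k → ℝ} (h : S.IsStrictlyHyperbolicNear ubar) : S.IsSymmetrizableNear ubar := by
  obtain ⟨U, hU, hU'⟩ := h
  refine ⟨U, hU, fun u => symmetrizerOfPair (S.A0 u) (S.A 0 u),
    fun i i' => contDiff_symmetrizerOfPair_apply S.contDiff_A0 (S.contDiff_A 0) i i',
    fun u hu => ⟨?_, fun j => ?_⟩⟩
  · obtain ⟨hdet, hsh⟩ := hU' u hu
    have hξ : (fun _ : Fin 1 => (1 : ℝ)) ≠ 0 := fun h0 => one_ne_zero (congr_fun h0 0)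
    obtain ⟨lam, hinj, hchar⟩ := IsStrictlyHyperbolicAt.charpoly_adjugate_mul_eq_prod hdet hsh hξ
    rw [Fin.sum_univ_one, one_smul] at hchar
    exact posDef_symmetrizerOfPair_mul_left hdet hinj hchar
  · rw [Subsingleton.elim j 0]
    exact isSymm_symmetrizerOfPair_mul_right _ _

/-- **No space variables (`d = 0`)**: `det A₀ ≠ 0` near `ū` already makes the system
symmetrizable, with `Sym = A₀ᵀ` (`A₀ᵀA₀` is symmetric positive definite). [folklore] -/
theorem IsStrictlyHyperbolicNear.isSymmetrizableNear_of_d_eq_zero {S : QuasilinearSystem 0 k}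
    {ubar : Fin k → ℝ} (h : S.IsStrictlyHyperbolicNear ubar) : S.IsSymmetrizableNear ubar := by
  obtain ⟨U, hU, hU'⟩ := h
  refine ⟨U, hU, fun u => (S.A0 u)ᵀ, fun i i' => S.contDiff_A0 i' i, fun u hu => ⟨?_, fun j => j.elim0⟩⟩
  obtain ⟨hdet, -⟩ := hU' u hu
  have hinj : Function.Injective (S.A0 u).mulVec :=
    mulVec_injective_iff_isUnit.2 ((isUnit_iff_isUnit_det _).2 (isUnit_iff_ne_zero.2 hdet))
  refine Matrix.PosDef.of_dotProduct_mulVec_pos ?_ fun x hx => ?_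
  · show ((S.A0 u)ᵀ * S.A0 u)ᴴ = (S.A0 u)ᵀ * S.A0 u
    rw [conjTranspose_eq_transpose_of_trivial, transpose_mul, transpose_transpose]
  · rw [star_trivial, ← mulVec_mulVec, dotProduct_mulVec, vecMul_transpose]
    have hne : S.A0 u *ᵥ x ≠ 0 := fun h0 => hx (hinj (by rw [h0, mulVec_zero]))
    exact lt_of_le_of_ne (dotProduct_self_nonneg_real _)
      (Ne.symm fun h0 => hne (dotProduct_self_eq_zero.1 h0))

end QuasilinearSystem

open QuasilinearSystem

variable {d k : ℕ}

/-! ### Finite speed of propagation for `d ≤ 1`, and what remains of the named fact -/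

/-- **Finite speed of propagation for strictly hyperbolic systems in one space dimension**
(`d = 1`, any `k`): by symmetrizability and the discharged symmetrizable case.
[cite: Rauch1986, Proof of Theorem p. 482 and Example 1] -/
theorem hasPropagationSpeed_of_isStrictlyHyperbolicNear_of_d_eq_one (S : QuasilinearSystem 1 k)
    {ubar : Fin k → ℝ} (hB : S.B ubar = 0) (h : S.IsStrictlyHyperbolicNear ubar) :
    ∃ c : ℝ, 0 ≤ c ∧ S.HasPropagationSpeed ubar c :=
  Rauch1986_finitePropagationSpeed_symmetrizable_holds S ubar hB h.isSymmetrizableNear_of_d_eq_one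

/-- The degenerate case `d = 0`. [folklore] -/
theorem hasPropagationSpeed_of_isStrictlyHyperbolicNear_of_d_eq_zero (S : QuasilinearSystem 0 k)
    {ubar : Fin k → ℝ} (hB : S.B ubar = 0) (h : S.IsStrictlyHyperbolicNear ubar) :
    ∃ c : ℝ, 0 ≤ c ∧ S.HasPropagationSpeed ubar c :=
  Rauch1986_finitePropagationSpeed_symmetrizable_holds S ubar hB h.isSymmetrizableNear_of_d_eq_zero

/-- **Rauch's fact `Rauch1986_finitePropagationSpeed` holds unconditionally for `d ≤ 1`**
(one space dimension, Rauch's Example 1; every `k`): both alternatives of the class are then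
symmetrizable. [cite: Rauch1986, Example 1 and Proof of Theorem p. 482] -/
theorem exists_hasPropagationSpeed_of_isRauchClass_of_d_le_one {d k : ℕ} (hd : d ≤ 1)
    (S : QuasilinearSystem d k) (ubar : Fin k → ℝ) (hS : S.IsRauchClass ubar) :
    ∃ c : ℝ, 0 ≤ c ∧ S.HasPropagationSpeed ubar c := by
  rcases hS.symmetrizableNear_or with h | h
  · exact Rauch1986_finitePropagationSpeed_symmetrizable_holds S ubar hS.B_eq_zero h
  rcases Nat.le_one_iff_eq_zero_or_eq_one.1 hd with rfl | rfl
  · exact hasPropagationSpeed_of_isStrictlyHyperbolicNear_of_d_eq_zero S hS.B_eq_zero h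
  · exact hasPropagationSpeed_of_isStrictlyHyperbolicNear_of_d_eq_one S hS.B_eq_zero h

/-- **What remains of the strictly hyperbolic case**: finite speed of propagation for every
system (1) with `B(ū) = 0` that is strictly hyperbolic with `A₀` invertible near `ū` (the
strictly hyperbolic half of `Rauch1986_finitePropagationSpeed`, in every `d`, `k`) follows from
its sub-case `d ≥ 2`, `k ≥ 2` (several space dimensions, genuine systems — where strictly
hyperbolic systems need not admit a matrix symmetrizer and the printed proofs use symbolic
symmetrizers [Taylor1981, Ch. IV §3 Prop. 3.1, §4 Thm 4.5]); the cases `d ≤ 1` (this file) and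
`k ≤ 1` (`exists_hasPropagationSpeed_of_isRauchClass_of_le_one`) are proved.
[cite: Rauch1986, Proof of Theorem p. 482] -/
theorem Rauch1986_finitePropagationSpeed_strictlyHyperbolic_of_two_le
    (h : ∀ ⦃d k : ℕ⦄, 2 ≤ d → 2 ≤ k → ∀ (S : QuasilinearSystem d k) (ubar : Fin k → ℝ),
      S.B ubar = 0 → S.IsStrictlyHyperbolicNear ubar → ∃ c : ℝ, 0 ≤ c ∧ S.HasPropagationSpeed ubar c)
    ⦃d k : ℕ⦄ (S : QuasilinearSystem d k) (ubar : Fin k → ℝ) (hB : S.B ubar = 0)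
    (hS : S.IsStrictlyHyperbolicNear ubar) : ∃ c : ℝ, 0 ≤ c ∧ S.HasPropagationSpeed ubar c := by
  by_cases hd : 2 ≤ d
  · by_cases hk : 2 ≤ k
    · exact h hd hk S ubar hB hS
    · exact exists_hasPropagationSpeed_of_isRauchClass_of_le_one (by omega) S ubar
        (IsRauchClass.of_isStrictlyHyperbolicNear hB hS)
  · exact exists_hasPropagationSpeed_of_isRauchClass_of_d_le_one (by omega) S ubar
      (IsRauchClass.of_isStrictlyHyperbolicNear hB hS)

/-- Hence the original fact `Rauch1986_finitePropagationSpeed` rests only on the strictly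
hyperbolic case with `d ≥ 2`, `k ≥ 2`. [cite: Rauch1986, Proof of Theorem p. 482] -/
theorem Rauch1986_finitePropagationSpeed_of_two_le
    (h : ∀ ⦃d k : ℕ⦄, 2 ≤ d → 2 ≤ k → ∀ (S : QuasilinearSystem d k) (ubar : Fin k → ℝ),
      S.B ubar = 0 → S.IsStrictlyHyperbolicNear ubar → ∃ c : ℝ, 0 ≤ c ∧ S.HasPropagationSpeed ubar c) :
    Rauch1986_finitePropagationSpeed :=
  Rauch1986_finitePropagationSpeed_of_strictlyHyperbolic
    (Rauch1986_finitePropagationSpeed_strictlyHyperbolic_of_two_le h)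

/-! ### The symbolic symmetrizer of a strictly hyperbolic system (any dimension) -/

/-- **The symbolic symmetrizer** `r(u, ξ) = Sym(A₀(u), Σⱼ ξⱼAⱼ(u))` of a system that is strictly
hyperbolic with `A₀` invertible near `ū`: jointly smooth in `(u, ξ)` (a polynomial in `ξ`), and
for `u` near `ū` and every `ξ ≠ 0`, `r(u, ξ)A₀(u)` is symmetric positive definite and
`r(u, ξ) Σⱼ ξⱼAⱼ(u)` is symmetric — the symbol-level content ("`r₀(t, x, ξ)` is a positive
definite matrix", "`r₀P₁` is self adjoint") of the symmetrizer of a strictly hyperbolic operator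
[Taylor1981, Ch. IV §3 Def. 3.2 and Prop. 3.1], before normalisation to homogeneity of degree
`0` in `ξ` (restrict to `‖ξ‖ = 1`) and without the pseudodifferential calculus.
[cite: Taylor1981, Ch. IV §3 Prop. 3.1; HornJohnson2013, §7.6 Problem 7.6.P1] -/
theorem QuasilinearSystem.IsStrictlyHyperbolicNear.exists_symbolicSymmetrizer
    {S : QuasilinearSystem d k} {ubar : Fin k → ℝ} (h : S.IsStrictlyHyperbolicNear ubar) :
    ∃ U ∈ 𝓝 ubar, ∃ r : (Fin k → ℝ) → (Fin d → ℝ) → Matrix (Fin k) (Fin k) ℝ,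
      (∀ i i', ContDiff ℝ ∞ fun p : (Fin k → ℝ) × (Fin d → ℝ) => r p.1 p.2 i i') ∧
      ∀ u ∈ U, ∀ ξ : Fin d → ℝ, ξ ≠ 0 →
        (r u ξ * S.A0 u).PosDef ∧ (r u ξ * S.A0 u).IsSymm ∧
          (r u ξ * ∑ j, ξ j • S.A j u).IsSymm := by
  obtain ⟨U, hU, hU'⟩ := h
  -- the pencil `(u, ξ) ↦ Σⱼ ξⱼ Aⱼ(u)` and `(u, ξ) ↦ A₀(u)` have smooth entries
  have hA0 : ∀ i i', ContDiff ℝ ∞ fun p : (Fin k → ℝ) × (Fin d → ℝ) => S.A0 p.1 i i' :=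
    fun i i' => (S.contDiff_A0 i i').comp contDiff_fst
  have hP : ∀ i i', ContDiff ℝ ∞ fun p : (Fin k → ℝ) × (Fin d → ℝ) =>
      (∑ j, p.2 j • S.A j p.1) i i' := by
    intro i i'
    simp only [Matrix.sum_apply, Matrix.smul_apply, smul_eq_mul]
    exact ContDiff.sum fun j _ =>
      ((contDiff_apply ℝ ℝ j).comp contDiff_snd).mul ((S.contDiff_A j i i').comp contDiff_fst)
  refine ⟨U, hU, fun u ξ => symmetrizerOfPair (S.A0 u) (∑ j, ξ j • S.A j u),
    fun i i' => contDiff_symmetrizerOfPair_apply hA0 hP i i', fun u hu ξ hξ => ?_⟩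
  obtain ⟨hdet, hsh⟩ := hU' u hu
  obtain ⟨lam, hinj, hchar⟩ := IsStrictlyHyperbolicAt.charpoly_adjugate_mul_eq_prod hdet hsh hξ
  exact ⟨posDef_symmetrizerOfPair_mul_left hdet hinj hchar, isSymm_symmetrizerOfPair_mul_left _ _,
    isSymm_symmetrizerOfPair_mul_right _ _⟩

end Literature.Barriers.AtomisticToContinuum

end
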